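import Literature.NumberTheory.QuadraticFields.LatticeSumPrincipal
import Mathlib.Data.ZMod.QuotientRing
import HarnessLib

/-!
# The partial zeta function of an ideal class of an imaginary quadratic field is half an
# Epstein zeta function: `Σ_{[𝔞] = [𝔟]⁻¹} ψ(N𝔞) N𝔞^{−s} = ½ Σ'_{(x,y)} ψ(Q(x,y)) Q(x,y)^{−s}`

Topic `NumberTheory/QuadraticFields`, namespace `Literature.NumberTheory.QuadraticFields.Quadratic`
(continuing `FormIdeals.lean` and `LatticeSumPrincipal.lean`, which treats the principal class of a
principal `𝓞 K`). Everything here is PROVED (theorems only, no definitions, no named facts).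

Let `K` be an imaginary quadratic field with `d_K < −4`, `(1, ω)` an integral basis with
`ω² = m + tω` (`d_K = t² + 4m`), and `𝔟 = (A, ω − k)` the lattice ideal `ℤA ⊕ ℤ(ω − k)` of a form
`(A, 2k − t, C)` of discriminant `d_K` (`A > 0`, `AC = k² − tk − m`, `FormIdeals.lean`). We prove:

* `absNorm_span_pair_eq` — **`N𝔟 = A`**: `n ↦ n mod 𝔟` induces `ℤ/Aℤ ≅ 𝓞 K/𝔟`
  (every `u + vω ≡ u + vk`, and `n ∈ 𝔟 ⇔ A ∣ n`, `intCast_mem_span_pair_iff`);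
* `norm_lattice_elt` — `N(xA + y(ω − k)) = A · (Ax² + (t − 2k)xy + Cy²)`;
* `tsum_ideal_mul_isPrincipal_eq_half_twistZeta` — **the class-sum identity**: for a Dirichlet
  character `ψ` and `Re s > 1`,
  `Σ_{𝔞 : 𝔟𝔞 principal} ψ(N𝔞) N𝔞^{−s} = ½ Σ'_{(x,y) ∈ ℤ²} ψ(Q(x,y)) Q(x,y)^{−s}` with
  `Q = (A, t − 2k, C)` (the opposite of the form of `𝔟`): the map `α = xA + y(ω − k) ↦ 𝔞 = (α)𝔟⁻¹`
  is two-to-one (units `±1`, `units_eq`) from `𝔟 ∖ 0` onto the integral ideals `𝔞` with `𝔟𝔞`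
  principal — the ideals of the class `[𝔟]⁻¹` (Mathlib `ClassGroup.mk0_eq_mk0_inv_iff`) together with
  `𝔞 = 0`, which contributes `0` to both sides — and `N𝔞 = N(α)/N𝔟 = Q(x, y)`.

This is the classical passage from the Dedekind zeta function to Epstein zeta functions of forms
class by class (Dirichlet; e.g. Zagier, *Zetafunktionen und quadratische Körper*, §8, Satz 3 and
its proof: "`ζ(s, A) = (1/w) Σ' Q(x,y)^{−s}`"; Cox, *Primes of the form x² + ny²*, Thm. 7.7 for the
dictionary `(a, (−b+√D)/2) ↔ (a, b, c)`), used by Granville–Stark, §3.2 (Selberg–Chowla summed over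
the classes). Mathlib has `ClassGroup`, `Ideal.absNorm` (multiplicative), unique factorisation of
ideals in Dedekind domains, but no quadratic-field dictionary (searched `Epstein`, `partial zeta`,
`form class`: tree only).

## References

* D. B. Zagier, *Zetafunktionen und quadratische Körper*, Springer 1981, §8 (Satz 3).
* [Cox2013] D. A. Cox, *Primes of the form x² + ny²*, 2nd ed. (2013), §7.B Thm. 7.7.
* [GranvilleStark2000] A. Granville, H. M. Stark, Invent. Math. 139 (2000), §3.2.
-/

noncomputable section

open Module NumberField Ideal
open Literature.Barriers.RiemannHypothesis Literature.NumberTheory.QuadraticFields.BakerLimitFormula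

namespace Literature.NumberTheory.QuadraticFields.Quadratic

variable {K : Type*} [Field K] [NumberField K]

/-! ### The norm of the lattice ideal `(A, ω − k)` -/

omit [NumberField K] in
/-- **`N(A, ω − k) = |A|`**: for `AC = k² − tk − m` the quotient `𝓞 K/(A, ω − k)` is
`ℤ/Aℤ` — the map `n ↦ n` is onto (`u + vω ≡ u + vk`) with kernel `Aℤ`
(`intCast_mem_span_pair_iff`). Cox, Thm. 7.7(i): "`N(𝔞) = a`" for `𝔞 = [a, (−b + √D)/2]`.
[cite: Cox2013, §7.B Thm. 7.7] -/
theorem absNorm_span_pair_eq [IsDedekindDomain (𝓞 K)] [Module.Free ℤ (𝓞 K)]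
    (b : Basis (Fin 2) ℤ (𝓞 K)) (hb : b 0 = 1) {t m : ℤ}
    (hω : b 1 * b 1 = (m : 𝓞 K) + (t : 𝓞 K) * b 1) {A k C : ℤ}
    (hn : A * C = k ^ 2 - t * k - m) :
    absNorm (span {(A : 𝓞 K), b 1 - k}) = A.natAbs := by
  set 𝔟 : Ideal (𝓞 K) := span {(A : 𝓞 K), b 1 - k} with h𝔟
  set f : ℤ →+* 𝓞 K ⧸ 𝔟 := (Ideal.Quotient.mk 𝔟).comp (algebraMap ℤ (𝓞 K)) with hf
  have hsurj : Function.Surjective f := by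
    intro y
    obtain ⟨x, rfl⟩ := Ideal.Quotient.mk_surjective y
    obtain ⟨u, v, hx⟩ : ∃ u v : ℤ, x = (u : 𝓞 K) + (v : 𝓞 K) * b 1 :=
      ⟨_, _, eq_repr_add_repr_mul_of_basis b hb x⟩
    refine ⟨u + v * k, ?_⟩
    rw [hf, RingHom.comp_apply, Ideal.Quotient.mk_eq_mk_iff_sub_mem]
    have : (algebraMap ℤ (𝓞 K)) (u + v * k) - x = -(v : 𝓞 K) * (b 1 - k) := by
      rw [hx]
      simp only [eq_intCast, Int.cast_add, Int.cast_mul]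
      ring
    rw [this]
    exact Ideal.mul_mem_left _ _ (Ideal.subset_span (by simp))
  have hker : RingHom.ker f = span {(A : ℤ)} := by
    ext n
    rw [RingHom.mem_ker, hf, RingHom.comp_apply, Ideal.Quotient.eq_zero_iff_mem, eq_intCast,
      intCast_mem_span_pair_iff b hb hω hn n, Ideal.mem_span_singleton]
  have e : (𝓞 K ⧸ 𝔟) ≃+* ZMod A.natAbs :=
    ((RingHom.quotientKerEquivOfSurjective hsurj).symm.trans (Ideal.quotEquivOfEq hker)).trans
      (Int.quotientSpanEquivZMod A)
  rw [Ideal.absNorm_apply, Submodule.cardQuot_apply, Nat.card_congr e.toEquiv, Nat.card_zmod]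

omit [NumberField K] in
/-- **The norm of a lattice element**: `N(xA + y(ω − k)) = A (Ax² + (t − 2k)xy + Cy²)` when
`AC = k² − tk − m` (the norm form of `𝔟 = (A, ω − k)` is `A` times the form `(A, t − 2k, C)`,
the opposite `(a, −b, c)` of Cox's `(A, 2k − t, C)`). [cite: Cox2013, §7.B Thm. 7.7 (proof, (7.16))] -/
theorem norm_lattice_elt (b : Basis (Fin 2) ℤ (𝓞 K)) (hb : b 0 = 1) {t m : ℤ}
    (hω : b 1 * b 1 = (m : 𝓞 K) + (t : 𝓞 K) * b 1) {A k C : ℤ}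
    (hn : A * C = k ^ 2 - t * k - m) (x y : ℤ) :
    Algebra.norm ℤ ((x : 𝓞 K) * A + (y : 𝓞 K) * (b 1 - k)) =
      A * (A * x ^ 2 + (t - 2 * k) * x * y + C * y ^ 2) := by
  have e : (x : 𝓞 K) * A + (y : 𝓞 K) * (b 1 - k) = ((x * A - y * k : ℤ) : 𝓞 K) + (y : 𝓞 K) * b 1 := by
    push_cast; ring
  rw [e, norm_intCast_add_intCast_mul b hb hω]
  linear_combination (-(y ^ 2)) * hn

/-! ### The class-sum identity -/

/-- The real form `(A, t − 2k, C)` is positive definite (its discriminant is `t² + 4m < 0`).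
[folklore] -/
theorem isPosDefForm_lattice {t m A k C : ℤ} (hD : t ^ 2 + 4 * m < 0) (hA : 0 < A)
    (hn : A * C = k ^ 2 - t * k - m) :
    IsPosDefForm (A : ℝ) ((t - 2 * k : ℤ) : ℝ) (C : ℝ) := by
  refine ⟨by exact_mod_cast hA, ?_⟩
  have h : (t - 2 * k) ^ 2 - 4 * A * C = t ^ 2 + 4 * m := by linear_combination (-4 : ℤ) * hn
  have : (((t - 2 * k) ^ 2 - 4 * A * C : ℤ) : ℝ) < 0 := by rw [h]; exact_mod_cast hD
  push_cast at this ⊢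
  linarith

/-- **The partial zeta function of the class `[𝔟]⁻¹` is half an Epstein zeta function.** Let
`K` be an imaginary quadratic field (here: any number field with an integral basis `(1, ω)`,
`ω² = m + tω`, `t² + 4m < −4`, so that the units are `±1`), `𝔟 = (A, ω − k)` with `A > 0`,
`AC = k² − tk − m`, `ψ` a Dirichlet character and `Re s > 1`. Then
`Σ_{𝔞 : 𝔟𝔞 principal} ψ(N𝔞) N𝔞^{−s} = ½ Σ'_{(x,y)} ψ(Q(x,y)) Q(x,y)^{−s}`, `Q = (A, t − 2k, C)`;
the 𝔞 ≠ 0 with `𝔟𝔞` principal are exactly the integral ideals of the class `[𝔟]⁻¹`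
(`ClassGroup.mk0_eq_mk0_inv_iff`). Proof: `(x, y) ↦ α = xA + y(ω − k)` is a bijection `ℤ² ≅ 𝔟`;
`α ↦ 𝔞` with `(α) = 𝔟𝔞` is two-to-one off `0` (`(α) = (α') ⇔ α' = ±α`) onto these `𝔞`, and
`N𝔞 = N(α)/N𝔟 = Q(x, y)` (`norm_lattice_elt`, `absNorm_span_pair_eq`). Zagier, §8:
"`ζ(s, A) = (1/w) Σ'_{x,y} Q(x,y)^{−s}`". [cite: Cox2013, §7.B Thm. 7.7] -/
theorem tsum_ideal_mul_isPrincipal_eq_half_twistZeta (b : Basis (Fin 2) ℤ (𝓞 K)) (hb : b 0 = 1)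
    {t m : ℤ} (hω : b 1 * b 1 = (m : 𝓞 K) + (t : 𝓞 K) * b 1) (hD : t ^ 2 + 4 * m < -4)
    {A k C : ℤ} (hA : 0 < A) (hn : A * C = k ^ 2 - t * k - m)
    {N : ℕ} [NeZero N] (ψ : DirichletCharacter ℂ N) {s : ℂ} (hs : 1 < s.re) :
    ∑' J : {J : Ideal (𝓞 K) // (span {(A : 𝓞 K), b 1 - k} * J).IsPrincipal},
        ψ (absNorm J.1) * ((absNorm J.1 : ℕ) : ℂ) ^ (-s) =
      1 / 2 * twistZeta (fun p : ℤ × ℤ =>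
          ψ ((A * p.1 ^ 2 + (t - 2 * k) * p.1 * p.2 + C * p.2 ^ 2 : ℤ) : ZMod N))
        (A : ℝ) ((t - 2 * k : ℤ) : ℝ) (C : ℝ) s := by
  classical
  have hs0 : s ≠ 0 := fun h => by rw [h, Complex.zero_re] at hs; linarith
  have hD' : t ^ 2 + 4 * m < 0 := by linarith
  have hpos := isPosDefForm_lattice hD' hA hn
  set 𝔟 : Ideal (𝓞 K) := span {(A : 𝓞 K), b 1 - k} with h𝔟
  have h𝔟0 : 𝔟 ≠ 0 := by
    intro h0
    have hmem : (A : 𝓞 K) ∈ 𝔟 := Ideal.subset_span (by simp)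
    rw [h0] at hmem
    have h1 : (A : 𝓞 K) = 0 := by simpa using hmem
    exact hA.ne' (intCast_eq_zero_of_basis b hb h1)
  -- (1) the lattice bijection `ℤ² ≃ 𝔟`
  set φ : ℤ × ℤ → 𝔟 := fun p => ⟨(p.1 : 𝓞 K) * A + (p.2 : 𝓞 K) * (b 1 - k),
    (mem_span_pair_iff_of_basis b hb hω hn _).2 ⟨p.1, p.2, rfl⟩⟩ with hφ
  have hφ_bij : Function.Bijective φ := by
    constructor
    · intro p q hpq
      have h := congrArg Subtype.val hpq
      simp only [hφ] at h
      obtain ⟨h1, h2⟩ := lattice_coords_unique b hb hA.ne' h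
      exact Prod.ext h1 h2
    · rintro ⟨x, hx⟩
      obtain ⟨u, v, rfl⟩ := (mem_span_pair_iff_of_basis b hb hω hn x).1 hx
      exact ⟨(u, v), rfl⟩
  set e : ℤ × ℤ ≃ 𝔟 := Equiv.ofBijective φ hφ_bij with he
  have he_apply : ∀ p : ℤ × ℤ, ((e p : 𝔟) : 𝓞 K) = (p.1 : 𝓞 K) * A + (p.2 : 𝓞 K) * (b 1 - k) :=
    fun p => rfl
  -- (2) the cofactor ideal `J(α)`: `(α) = 𝔟 · J(α)`
  have hdvd : ∀ α : 𝔟, 𝔟 ∣ span {(α : 𝓞 K)} := fun α =>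
    Ideal.dvd_iff_le.mpr ((Ideal.span_singleton_le_iff_mem _).mpr α.2)
  set Jof : 𝔟 → Ideal (𝓞 K) := fun α => Classical.choose (hdvd α) with hJof
  have hJof_spec : ∀ α : 𝔟, span {(α : 𝓞 K)} = 𝔟 * Jof α := fun α => Classical.choose_spec (hdvd α)
  have hJof_uniq : ∀ (α : 𝔟) (J : Ideal (𝓞 K)), span {(α : 𝓞 K)} = 𝔟 * J → J = Jof α := by
    intro α J hJ
    have : 𝔟 * J = 𝔟 * Jof α := hJ.symm.trans (hJof_spec α)
    exact mul_left_cancel₀ h𝔟0 this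
  -- `J(α) = J(α') ↔ α' = ±α`
  have hJof_eq_iff : ∀ α α' : 𝔟, Jof α = Jof α' ↔ (α' = α ∨ α' = -α) := by
    intro α α'
    constructor
    · intro h
      have this : span {(α : 𝓞 K)} = span {(α' : 𝓞 K)} := by rw [hJof_spec α, hJof_spec α', h]
      rcases (span_singleton_eq_span_singleton_iff' b hb hω hD _ _).1 this with h' | h'
      · exact Or.inl (Subtype.ext h')
      · refine Or.inr (Subtype.ext ?_)
        rw [Submodule.coe_neg]
        exact h'
    · rintro (rfl | rfl)
      · rfl
      · refine hJof_uniq (-α) (Jof α) ?_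
        rw [Submodule.coe_neg, Ideal.span_singleton_neg]
        exact hJof_spec α
  -- the norm of `J(e p)`
  have h𝔟N : absNorm 𝔟 = A.natAbs := absNorm_span_pair_eq b hb hω hn
  have hnormJ : ∀ p : ℤ × ℤ, ((absNorm (Jof (e p)) : ℕ) : ℤ) =
      A * p.1 ^ 2 + (t - 2 * k) * p.1 * p.2 + C * p.2 ^ 2 := by
    intro p
    have h1 := congrArg absNorm (hJof_spec (e p))
    rw [map_mul, Ideal.absNorm_span_singleton, he_apply, norm_lattice_elt b hb hω hn, h𝔟N] at h1
    have hQ : 0 ≤ A * p.1 ^ 2 + (t - 2 * k) * p.1 * p.2 + C * p.2 ^ 2 := by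
      have := hpos.eval_pos (p := p)
      by_cases hp : p = 0
      · subst hp; simp
      · have h := (this hp).le
        unfold bqfEval at h
        exact_mod_cast h
    have h2 : (A * (A * p.1 ^ 2 + (t - 2 * k) * p.1 * p.2 + C * p.2 ^ 2)).natAbs =
        A.natAbs * (A * p.1 ^ 2 + (t - 2 * k) * p.1 * p.2 + C * p.2 ^ 2).natAbs := Int.natAbs_mul _ _
    rw [h2] at h1
    have h3 := Nat.eq_of_mul_eq_mul_left (Int.natAbs_pos.mpr hA.ne') h1
    rw [← h3, Int.natAbs_of_nonneg hQ]
  -- (3) the summand along `e`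
  set G : Ideal (𝓞 K) → ℂ := fun I => ψ (absNorm I) * ((absNorm I : ℕ) : ℂ) ^ (-s) with hG
  set F : 𝔟 → ℂ := fun α => G (Jof α) with hF
  set w : ℤ × ℤ → ℂ := fun p =>
    ψ ((A * p.1 ^ 2 + (t - 2 * k) * p.1 * p.2 + C * p.2 ^ 2 : ℤ) : ZMod N) with hw
  have hG_bot : G ⊥ = 0 := by
    simp only [hG, Ideal.absNorm_bot, Nat.cast_zero, Complex.zero_cpow (neg_ne_zero.mpr hs0), mul_zero]
  have hterm : ∀ p : ℤ × ℤ, twistTerm w (A : ℝ) ((t - 2 * k : ℤ) : ℝ) (C : ℝ) s p = F (e p) := by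
    intro p
    simp only [twistTerm, epsteinTerm, hF, hG]
    by_cases hp : p = 0
    · rw [if_pos hp]
      have hJ0 : Jof (e p) = ⊥ := by
        refine (hJof_uniq (e p) ⊥ ?_).symm
        rw [he_apply, hp]
        simp
      rw [hJ0, Ideal.absNorm_bot]
      simp only [Nat.cast_zero, Complex.zero_cpow (neg_ne_zero.mpr hs0), mul_zero]
    · rw [if_neg hp]
      set n : ℕ := absNorm (Jof (e p)) with hnn
      have hnZ : (n : ℤ) = A * p.1 ^ 2 + (t - 2 * k) * p.1 * p.2 + C * p.2 ^ 2 := hnormJ p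
      have h1 : ((n : ℕ) : ZMod N) = ((A * p.1 ^ 2 + (t - 2 * k) * p.1 * p.2 + C * p.2 ^ 2 : ℤ) : ZMod N) := by
        rw [← hnZ, Int.cast_natCast]
      have h2 : ((n : ℕ) : ℂ) = (((bqfEval (A : ℝ) ((t - 2 * k : ℤ) : ℝ) (C : ℝ) p) : ℝ) : ℂ) := by
        have : bqfEval (A : ℝ) ((t - 2 * k : ℤ) : ℝ) (C : ℝ) p =
            ((A * p.1 ^ 2 + (t - 2 * k) * p.1 * p.2 + C * p.2 ^ 2 : ℤ) : ℝ) := by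
          unfold bqfEval; push_cast; ring
        rw [this, ← hnZ]
        norm_cast
      rw [h1, h2, hw]
  -- (4) the twisted Epstein sum is `Σ_α F(α)`
  have hsumT : Summable (twistTerm w (A : ℝ) ((t - 2 * k : ℤ) : ℝ) (C : ℝ) s) :=
    (summable_norm_twistTerm hpos (fun p => DirichletCharacter.norm_le_one ψ _) hs).of_norm
  have hsumF : Summable F := (e.summable_iff).mp (hsumT.congr fun p => hterm p)
  have hZ : twistZeta w (A : ℝ) ((t - 2 * k : ℤ) : ℝ) (C : ℝ) s = ∑' α : 𝔟, F α := by
    unfold twistZeta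
    rw [← e.tsum_eq F]
    exact tsum_congr hterm
  -- (5) the fibres of `J`: `{±α₀}` over the ideals `I` with `𝔟I` principal, `∅` otherwise
  have hfib := hsumF.hasSum.tsum_fiberwise Jof
  have hinner : ∀ I : Ideal (𝓞 K), (∑' α : ↥(Jof ⁻¹' {I}), F α) =
      Set.indicator {I | (𝔟 * I).IsPrincipal} (fun I => 2 * G I) I := by
    intro I
    by_cases hI : (𝔟 * I).IsPrincipal
    · rw [Set.indicator_of_mem (show I ∈ {I | (𝔟 * I).IsPrincipal} from hI)]
      -- a generator `β` of `𝔟I`, as an element `α₀ ∈ 𝔟`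
      obtain ⟨β, hβ⟩ : ∃ β : 𝓞 K, 𝔟 * I = span {β} := ⟨_, hI.span_singleton_generator.symm⟩
      have hβmem : β ∈ 𝔟 := by
        have : β ∈ 𝔟 * I := by rw [hβ]; exact Ideal.mem_span_singleton_self β
        exact Ideal.mul_le_right this
      set α₀ : 𝔟 := ⟨β, hβmem⟩ with hα₀
      have hJα₀ : Jof α₀ = I := (hJof_uniq α₀ I hβ.symm).symm
      have hset : (Jof ⁻¹' {I}) = {α₀, -α₀} := by
        ext α
        simp only [Set.mem_preimage, Set.mem_singleton_iff, Set.mem_insert_iff]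
        rw [← hJα₀, eq_comm, hJof_eq_iff α₀ α]
      rw [tsum_subtype (Jof ⁻¹' {I}) F, hset]
      by_cases hβ0 : β = 0
      · -- `𝔟I = 0`, so `I = 0` and the fibre is `{0}`
        have hI0 : I = ⊥ := by
          have : 𝔟 * I = ⊥ := by rw [hβ, hβ0]; simp
          exact (Ideal.mul_eq_bot.mp this).resolve_left h𝔟0
        have hα00 : α₀ = 0 := Subtype.ext hβ0
        rw [hα00, neg_zero, Set.pair_eq_singleton, tsum_eq_single 0 (fun α hα =>
          Set.indicator_of_notMem (by simpa using hα) F), Set.indicator_of_mem (Set.mem_singleton _)]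
        rw [← hα00]
        show G (Jof α₀) = 2 * G I
        rw [hJα₀, hI0, hG_bot, mul_zero]
      · have hne : α₀ ≠ -α₀ := by
          intro h
          have h' : (β : 𝓞 K) = -β := congrArg Subtype.val h
          have : (2 : 𝓞 K) * β = 0 := by linear_combination h'
          exact hβ0 ((mul_eq_zero.mp this).resolve_left (by norm_num))
        rw [tsum_eq_sum (s := {α₀, -α₀}) (fun α hα => Set.indicator_of_notMem (by simpa using hα) F),
          Finset.sum_pair hne, Set.indicator_of_mem (by simp), Set.indicator_of_mem (by simp)]
        have hJneg : Jof (-α₀) = I := by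
          rw [← (hJof_eq_iff α₀ (-α₀)).2 (Or.inr rfl)]
          exact hJα₀
        have h1 : F α₀ = G I := by
          show G (Jof α₀) = G I
          rw [hJα₀]
        have h2 : F (-α₀) = G I := by
          show G (Jof (-α₀)) = G I
          rw [hJneg]
        rw [h1, h2]
        ring
    · rw [Set.indicator_of_notMem (show I ∉ {I | (𝔟 * I).IsPrincipal} from hI)]
      have hempty : (Jof ⁻¹' {I}) = ∅ := by
        ext α
        simp only [Set.mem_preimage, Set.mem_singleton_iff, Set.mem_empty_iff_false, iff_false]
        intro h
        apply hI
        rw [← h, ← hJof_spec α]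
        exact ⟨⟨α, rfl⟩⟩
      rw [tsum_subtype (Jof ⁻¹' {I}) F, hempty]
      simp
  have hfib' : HasSum (Set.indicator {I | (𝔟 * I).IsPrincipal} (fun I => 2 * G I)) (∑' α : 𝔟, F α) := by
    have hfun : (fun I : Ideal (𝓞 K) => ∑' α : ↥(Jof ⁻¹' {I}), F α) =
        Set.indicator {I | (𝔟 * I).IsPrincipal} (fun I => 2 * G I) := funext hinner
    rw [← hfun]
    exact hfib
  have h2 : (∑' α : 𝔟, F α) =
      2 * ∑' J : {J : Ideal (𝓞 K) // (𝔟 * J).IsPrincipal}, G J.1 := by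
    rw [← hfib'.tsum_eq, ← tsum_subtype, tsum_mul_left]
    rfl
  rw [hZ, h2]
  ring

end Literature.NumberTheory.QuadraticFields.Quadratic
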